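import Mathlib
import HarnessLib
import Summits.HubbardSuperconductivity.HubbardSuperconductivity.Theorems.KLProgrammeKLRegimeEngineV8TwoLegMomentsExportGrid
import Summits.HubbardSuperconductivity.HubbardSuperconductivity.Theorems.KLProgrammeKLRegimeEngineScaleZeroResummedDecay

/-!
# Route `KLProgramme` — ENGINE child gen 8 (stmt-HubbardSuperconductivity-20437 `KLRegimeEngineV17F2`), class #7 in GRID currency ((Y′)-GRID):
# the scale-0 BASE of the grid atom `TwoLegGridMomentsAt … K 0` at an ARBITRARY ADMISSIBLE FRAME `K` (`FrameOK R U Nsc μ K`) — the base slot of the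
# scale telescope `…TwoLegGridMomentsTelescope` at the flow frame `K_n` (cell gate-hubbard-kl, seat hubbard-kl-k3c2-p3 g7; deliverable W3)

r2d-p1's n = 0 base (`twoLegGridMomentsAt_frameZero_of_bareAlpha`, p557865 §3) is the atom at `(K, n) = (0, 0)` — enough for the `n = 0` conjunct (`K_0 = 0`),
but the telescope that produces `TwoLegGridFlowMomentsAt … n` for `n ≥ 1` runs at the FIXED frame `K_n ≠ 0` and needs the base THERE.  At a general frame the
grid vertex `Ṽ = V_{4M} + 𝒩_{K,4M}` carries the quadratic counterterm, whose `gridLabelWt`-weighted pinned profile is `(|β|/N)·Σ_z ‖Ǩ_L(z)‖(1+|z|_∞)`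
(`sum_norm_kernel_gridVertex_mul_wt_le`, k3c2-p1) and is `O(|U|)` under `FrameOK` (`sum_norm_framePosKernel_mul_weight_le_of_frameOK`, k3c2-p1); everything else
is p3/p1b's generic one-step machinery (`twoLeg_time_sum_le`, `twoLeg_offDiag_moment_one_sum_le`) with k3c2-p1's frame-`K` Gram constant
(`isGramBoundedR_scaleZero_of_frameOK`, `κ₀ = √(2(7+1606732))`) and p3's frame-`K` weighted decay constant (`rowSum/colSum_scaleZero_gridLabelWt_le_X5`).

* §1 `normV_twoStep_eq` — `‖Ṽ‖_{h}` in closed form for a profile carried by degrees 2 and 4 only.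
* §2 **`twoLegGridMomentsAt_scaleZero_of_frameOK`** — `FrameOK R U Nsc μ K`, `R.WF`, `0 < U`, `|U| ≤ 1`, the volume thresholds, two numbers `a ≥ A(R,U,Nsc)`
  (p3's weighted decay constant at depth `Nsc`) and `f` with `Σ_z ‖Ǩ_L(z)‖(1+|z|_∞) ≤ f·|U|`, and the smallness `e·a·|U|·(4e⁴f + 16e⁸κ₀²) ≤ 1/2` ⇒
  `TwoLegGridMomentsAt L M (4e²a(4e⁴f + 16e⁸κ₀²)²) (8e²a(4e⁴f + 16e⁸κ₀²)²) β U μ K 0` (at `f = 0` these are r2d-p1's `(2^10, 2^11)·e¹⁸κ₀⁴·a`);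
  **`twoLegGridMomentsAt_scaleZero_of_frameOK_linear`** — the same with `f := κ_R + 2(Nsc+1)|U|·m_R` DISCHARGED from `FrameOK` (k3c2-p1's frame constants).

RESIDUAL (not here): the fit of `a(Nsc = nScales β)`, `f` and the smallness against the registered doors / allowance rows (`klE3Acum R`, DefsU*) — the
(b)/(e) closers' (`(nScales β + 1)·U² = O(c)` in the KL regime).  Proofs only; no definitions; nothing about the model's sizes is asserted; nothing asserts
superconductivity.  References: BGM 2006 §2.3 (2.17), §3 (3.2)–(3.8) [cite: BenfattoGiulianiMastropietro2006]; Pedra–Salmhofer 2008 Thm 2.4 [cite: PedraSalmhofer2008].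
-/

noncomputable section

namespace Summit.HubbardSuperconductivity.HubbardSuperconductivity.Theorems.EngineV8

set_option linter.dupNamespace false -- summit = problem name (single-conjunct summit), D-0017

open Real Finset Literature.MathematicalPhysics.QuantumLattice Literature.Probability.LatticeModels
open Literature.Probability.LatticeModels.BattleFederbush GrassmannAlgebra
open Summit.HubbardSuperconductivity.HubbardSuperconductivity.Theorems.KLRegimeSplit
open Summit.HubbardSuperconductivity.HubbardSuperconductivity.Theorems.KLProgrammeLegKernels

/-! ## §1 The field-weighted norm of a two-step profile -/

/-- **`‖Ṽ‖_h` for a profile carried by degrees `2` and `4`**: `normV Γ κ ρ (1 ↦ A, 2 ↦ B, else 0) = (e²(κ+ρ))²·A + (e²(κ+ρ))⁴·B` (`|Γ| ≥ 4`). -/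
theorem normV_twoStep_eq {Γ : Type*} [Fintype Γ] (hΓ : 4 ≤ Fintype.card Γ) (κ ρ A B : ℝ) :
    normV Γ κ ρ (fun m' => if m' = 1 then A else if m' = 2 then B else 0) = (Real.exp 2 * (κ + ρ)) ^ 2 * A + (Real.exp 2 * (κ + ρ)) ^ 4 * B := by
  rw [normV, Finset.sum_eq_add (a := 1) (b := 2) (by norm_num)]
  · simp
  · intro c _ hc
    rw [if_neg hc.1, if_neg hc.2, mul_zero]
  · intro h1
    exact absurd (Finset.mem_range.2 (by omega)) h1
  · intro h2
    exact absurd (Finset.mem_range.2 (by omega)) h2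

/-! ## §2 The grid atom at scale 0 and an admissible frame -/

section FrameBase

variable {L M : ℕ} [NeZero L] [NeZero M] {R : RenConsts} {μ U β : ℝ} {Nsc : ℕ} {K : TrigPolyC4v}

/-- **THE GRID ATOM AT `(K, 0)` FOR AN ADMISSIBLE FRAME** (`FrameOK R U Nsc μ K`, `R.WF`, `0 < U`, `|U| ≤ 1`, `klBetaMin ≤ β`, the volume thresholds):
with `a ≥ A(R,U,Nsc)` (p3's `gridLabelWt`-weighted decay constant of the scale-`0` grid covariance at frame depth `Nsc`, normalised by `N/β`), `f` with
`Σ_z ‖Ǩ_L(z)‖·(1+|z|_∞) ≤ f·|U|` (weighted `ℓ¹` size of the frame's position kernel) and the smallness `e·a·|U|·(4e⁴f + 16e⁸κ₀²) ≤ 1/2` (`= θ_w ≤ 1/2`):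
`TwoLegGridMomentsAt L M (4e²a(4e⁴f + 16e⁸κ₀²)²) (8e²a(4e⁴f + 16e⁸κ₀²)²) β U μ K 0`, `κ₀ = √(2(7+1606732))`. -/
theorem twoLegGridMomentsAt_scaleZero_of_frameOK (hK : FrameOK R U Nsc μ K) (hR : R.WF) (hU : 0 < U) (hU1 : |U| ≤ 1) (hβ : klBetaMin ≤ β)
    (hL : klEngL₃ β U ≤ L) (hM : klEngM₃ β U L ≤ M) {a f : ℝ} (ha : 0 < a)
    (hA : klScaleZeroA0 + uvTimeMomentConst klE0 7 32 +
          2 * (uvSpaceMomentConst klE0 1 (uvPieceSq klE0 (uvBaseQ klCutoffX5 klE0 4) (uvBaseQ' klCutoffX5 klE0 4)) +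
            (1 / 4 * Real.sqrt (216 * (1 / klE0 + 1 / 2)) *
                ∑ e : Fin 2 × Fin 2, (uvLinV klE0 (1 + (e.1 : ℕ) + (e.2 : ℕ)) *
                    (klCutoffX5 * ((1 + ((e.1 : ℕ) + (e.2 : ℕ)) + 2).factorial : ℝ) * (4 / klE0) ^ (1 + ((e.1 : ℕ) + (e.2 : ℕ)) + 1)) +
                  uvLinD klE0 (1 + (e.1 : ℕ) + (e.2 : ℕ)) *
                    (klCutoffX5 * ((1 + ((e.1 : ℕ) + (e.2 : ℕ)) + 3).factorial : ℝ) * (4 / klE0) ^ (1 + ((e.1 : ℕ) + (e.2 : ℕ)) + 2)))) *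
              (4608 * (1 + R.Gfr 0 + R.Gfr 1 + R.Gfr 2 + R.Gfr 3) ^ 4 * (((Nsc : ℝ) + 1) * U ^ 2 + 2 * |U|))) ≤ a)
    (hF : ∑ z : TorusSite 2 L, ‖framePosKernel L K z‖ * (1 + torusSiteDist z 0) ≤ f * |U|)
    (hsmall : Real.exp 1 * a * |U| * (4 * Real.exp 1 ^ 4 * f + 16 * Real.exp 1 ^ 8 * Real.sqrt (2 * (7 + 1606732)) ^ 2) ≤ 1 / 2) :
    TwoLegGridMomentsAt L M
      (4 * Real.exp 1 ^ 2 * a * (4 * Real.exp 1 ^ 4 * f + 16 * Real.exp 1 ^ 8 * Real.sqrt (2 * (7 + 1606732)) ^ 2) ^ 2)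
      (8 * Real.exp 1 ^ 2 * a * (4 * Real.exp 1 ^ 4 * f + 16 * Real.exp 1 ^ 8 * Real.sqrt (2 * (7 + 1606732)) ^ 2) ^ 2) β U μ K 0 := by
  haveI : NeZero (2 * (2 * M)) := ⟨by have := NeZero.ne M; omega⟩
  obtain ⟨hL15, hβL, -, -, -, -⟩ := scaleZero_regime_sizes (U := U) hβ hL hM
  have hβ0 : 0 < β := lt_of_lt_of_le (by norm_num [klBetaMin]) hβ
  have hN : (0 : ℝ) < ((2 * (2 * M) : ℕ) : ℝ) := by have := NeZero.ne M; positivity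
  have hκ : (0 : ℝ) < Real.sqrt (2 * (7 + 1606732)) := Real.sqrt_pos.2 (by norm_num)
  have hsc : klScale klE0 0 = klE0 := by simp [klScale]
  -- Gram constant and weighted decay of the frame-`K` scale-0 grid covariance
  have hGB := isGramBoundedR_scaleZero_of_frameOK (L := L) (M := M) hK hβ hL15 hβL
  have hαpos : 0 < ((2 * (2 * M) : ℕ) : ℝ) / β * a := by positivity
  have hrow : ∀ X, ∑ Y, ‖((hubbardGridSub L M β (2 * (2 * M))).transpose * hubbardCovAboveCT L M β μ 0 K klE0 *
      hubbardGridSub L M β (2 * (2 * M))) X Y‖ * gridLabelWt L (2 * (2 * M)) β {gridLegPos X, gridLegPos Y} ≤ ((2 * (2 * M) : ℕ) : ℝ) / β * a :=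
    fun X => (rowSum_scaleZero_gridLabelWt_le_X5 (L := L) (M := M) hK hR hU1 hβ hL hM X).trans
      (mul_le_mul_of_nonneg_left hA (div_nonneg hN.le hβ0.le))
  have hcol : ∀ Y, ∑ X, ‖((hubbardGridSub L M β (2 * (2 * M))).transpose * hubbardCovAboveCT L M β μ 0 K klE0 *
      hubbardGridSub L M β (2 * (2 * M))) X Y‖ * gridLabelWt L (2 * (2 * M)) β {gridLegPos X, gridLegPos Y} ≤ ((2 * (2 * M) : ℕ) : ℝ) / β * a :=
    fun Y => (colSum_scaleZero_gridLabelWt_le_X5 (L := L) (M := M) hK hR hU1 hβ hL hM Y).trans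
      (mul_le_mul_of_nonneg_left hA (div_nonneg hN.le hβ0.le))
  -- the weighted pinned profile of the grid vertex with counterterm
  set F₀ : ℝ := ∑ z : TorusSite 2 L, ‖framePosKernel L K z‖ * (1 + torusSiteDist z 0) with hF₀
  have hF₀0 : 0 ≤ F₀ := sum_nonneg fun z _ => mul_nonneg (norm_nonneg _) (by have : (0 : ℝ) ≤ torusSiteDist z 0 := Nat.cast_nonneg _; linarith)
  set Nw : ℕ → ℝ := fun m' => if m' = 1 then |β| / ((2 * (2 * M) : ℕ) : ℝ) * F₀ else if m' = 2 then |U| * |β| / ((2 * (2 * M) : ℕ) : ℝ) else 0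
    with hNw
  have hNw0 : ∀ m', 0 ≤ Nw m' := fun m' => by rw [hNw]; dsimp only; split_ifs <;> positivity
  have hNwle : ∀ m' (j : Fin (2 * m')) (w : GridLeg (GridPoint L (2 * (2 * M)))),
      ∑ Y ∈ univ.filter (fun Y : Fin (2 * m') → GridLeg (GridPoint L (2 * (2 * M))) => Y j = w),
        ‖kernel ℂ (hubbardGridInteraction L (2 * (2 * M)) β U + hubbardGridCounterQuadratic L (2 * (2 * M)) β K) (2 * m') Y‖ *
          gridLabelWt L (2 * (2 * M)) β ((univ.image Y).image gridLegPos) ≤ Nw m' :=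
    fun m' j w => by simpa only [hNw, hF₀] using sum_norm_kernel_gridVertex_mul_wt_le (L := L) (Ng := 2 * (2 * M)) β U hβ0.le K m' j w
  -- `‖Ṽ‖_h` and `θ_w` in closed form
  set P : ℝ := 4 * Real.exp 1 ^ 4 * F₀ + 16 * Real.exp 1 ^ 8 * Real.sqrt (2 * (7 + 1606732)) ^ 2 * |U| with hP
  set Q : ℝ := 4 * Real.exp 1 ^ 4 * f + 16 * Real.exp 1 ^ 8 * Real.sqrt (2 * (7 + 1606732)) ^ 2 with hQ
  have hP0 : 0 ≤ P := by rw [hP]; positivity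
  have hPle : P ≤ |U| * Q := by
    have h4 : 0 ≤ 4 * Real.exp 1 ^ 4 := by positivity
    have h := mul_le_mul_of_nonneg_left hF h4
    have hexp : |U| * Q = 4 * Real.exp 1 ^ 4 * (f * |U|) + 16 * Real.exp 1 ^ 8 * Real.sqrt (2 * (7 + 1606732)) ^ 2 * |U| := by
      rw [hQ]; ring
    rw [hexp, hP]
    exact add_le_add h le_rfl
  have he2 : Real.exp 2 = Real.exp 1 ^ 2 := by rw [← Real.exp_nat_mul]; norm_num
  have hnV : normV (GridLeg (GridPoint L (2 * (2 * M)))) (Real.sqrt (2 * (7 + 1606732))) (Real.sqrt (2 * (7 + 1606732))) Nw =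
      |β| / ((2 * (2 * M) : ℕ) : ℝ) * Real.sqrt (2 * (7 + 1606732)) ^ 2 * P := by
    rw [hNw, normV_twoStep_eq (four_le_card_gridLeg (L := L) (Ng := 2 * (2 * M))), he2, hP]
    ring
  have hXeq : (Real.sqrt (2 * (7 + 1606732)))⁻¹ ^ 2 *
      (Real.exp 1 * normV (GridLeg (GridPoint L (2 * (2 * M)))) (Real.sqrt (2 * (7 + 1606732))) (Real.sqrt (2 * (7 + 1606732))) Nw) =
        Real.exp 1 * (β / ((2 * (2 * M) : ℕ) : ℝ)) * P := by
    rw [hnV, abs_of_pos hβ0]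
    field_simp
  have hθeq : Real.exp 1 * (((2 * (2 * M) : ℕ) : ℝ) / β * a) *
      normV (GridLeg (GridPoint L (2 * (2 * M)))) (Real.sqrt (2 * (7 + 1606732))) (Real.sqrt (2 * (7 + 1606732))) Nw /
        Real.sqrt (2 * (7 + 1606732)) ^ 2 = Real.exp 1 * a * P := by
    rw [hnV, abs_of_pos hβ0]
    field_simp
  have hθ0 : 0 ≤ Real.exp 1 * a * P := by positivity
  have hθle : Real.exp 1 * a * P ≤ 1 / 2 := by
    refine le_trans ?_ hsmall
    have : Real.exp 1 * a * P ≤ Real.exp 1 * a * (|U| * Q) := mul_le_mul_of_nonneg_left hPle (by positivity)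
    linarith
  have hθlt : Real.exp 1 * (((2 * (2 * M) : ℕ) : ℝ) / β * a) *
      normV (GridLeg (GridPoint L (2 * (2 * M)))) (Real.sqrt (2 * (7 + 1606732))) (Real.sqrt (2 * (7 + 1606732))) Nw /
        Real.sqrt (2 * (7 + 1606732)) ^ 2 < 1 := by
    rw [hθeq]; linarith
  have hX0 : 0 ≤ Real.exp 1 * (β / ((2 * (2 * M) : ℕ) : ℝ)) * P := by positivity
  -- the common final estimate: `2·X·θ ≤ Z·U²·β/(2N)`
  have hfin : 2 * (Real.exp 1 * (β / ((2 * (2 * M) : ℕ) : ℝ)) * P) * (Real.exp 1 * a * P) ≤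
      4 * Real.exp 1 ^ 2 * a * Q ^ 2 * U ^ 2 * (β / (2 * ((2 * (2 * M) : ℕ) : ℝ))) := by
    have hP2 : P ^ 2 ≤ (|U| * Q) ^ 2 := pow_le_pow_left₀ hP0 hPle 2
    have hw : 0 ≤ 2 * Real.exp 1 ^ 2 * a * (β / ((2 * (2 * M) : ℕ) : ℝ)) := by positivity
    calc 2 * (Real.exp 1 * (β / ((2 * (2 * M) : ℕ) : ℝ)) * P) * (Real.exp 1 * a * P)
        = 2 * Real.exp 1 ^ 2 * a * (β / ((2 * (2 * M) : ℕ) : ℝ)) * P ^ 2 := by ring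
      _ ≤ 2 * Real.exp 1 ^ 2 * a * (β / ((2 * (2 * M) : ℕ) : ℝ)) * (|U| * Q) ^ 2 := mul_le_mul_of_nonneg_left hP2 hw
      _ = 4 * Real.exp 1 ^ 2 * a * Q ^ 2 * U ^ 2 * (β / (2 * ((2 * (2 * M) : ℕ) : ℝ))) := by
          rw [mul_pow, sq_abs]; field_simp; ring
  refine ⟨fun σ p₀ => ?_, fun σ p₀ => ?_⟩
  · have h := twoLeg_time_sum_le _ β U K hβ0.le hκ hGB Nw hNw0 hNwle hαpos hrow hcol hκ hθlt σ p₀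
    rw [hsc]
    refine h.trans ?_
    rw [hXeq, hθeq]
    exact (mul_div_one_sub_le_of_le_half hX0 hθ0 hθle).trans (hfin.trans (le_of_eq (by rw [hQ])))
  · have h := twoLeg_offDiag_moment_one_sum_le _ β U K hβ0.le hκ hGB Nw hNw0 hNwle hαpos hrow hcol hκ hθlt σ p₀
    rw [hsc]
    refine le_trans (le_of_eq (sum_congr rfl fun p₁ _ => by rw [pow_one])) (h.trans ?_)
    rw [hXeq, hθeq]
    have h2 := mul_le_mul_of_nonneg_left ((mul_div_one_sub_le_of_le_half hX0 hθ0 hθle).trans hfin) (zero_le_two (α := ℝ))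
    refine h2.trans (le_of_eq ?_)
    rw [hQ]; ring

/-- **THE SAME WITH THE FRAME'S POSITION-KERNEL SIZE DISCHARGED** (k3c2-p1's `sum_norm_framePosKernel_mul_weight_le_of_frameOK`):
`f := κ_R + 2(Nsc+1)|U|·m_R`, `κ_R = 256((4/3)√(24π²(Gfr0+1)(Gfr2+1)) + (128/15)(Gfr0+1))`, `m_R = 6(πGfr1/2 + π²Gfr2/(2√2) + π³Gfr3/8)`. -/
theorem twoLegGridMomentsAt_scaleZero_of_frameOK_linear (hK : FrameOK R U Nsc μ K) (hR : R.WF) (hU : 0 < U) (hU1 : |U| ≤ 1) (hβ : klBetaMin ≤ β)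
    (hL : klEngL₃ β U ≤ L) (hM : klEngM₃ β U L ≤ M) {a : ℝ} (ha : 0 < a)
    (hA : klScaleZeroA0 + uvTimeMomentConst klE0 7 32 +
          2 * (uvSpaceMomentConst klE0 1 (uvPieceSq klE0 (uvBaseQ klCutoffX5 klE0 4) (uvBaseQ' klCutoffX5 klE0 4)) +
            (1 / 4 * Real.sqrt (216 * (1 / klE0 + 1 / 2)) *
                ∑ e : Fin 2 × Fin 2, (uvLinV klE0 (1 + (e.1 : ℕ) + (e.2 : ℕ)) *
                    (klCutoffX5 * ((1 + ((e.1 : ℕ) + (e.2 : ℕ)) + 2).factorial : ℝ) * (4 / klE0) ^ (1 + ((e.1 : ℕ) + (e.2 : ℕ)) + 1)) +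
                  uvLinD klE0 (1 + (e.1 : ℕ) + (e.2 : ℕ)) *
                    (klCutoffX5 * ((1 + ((e.1 : ℕ) + (e.2 : ℕ)) + 3).factorial : ℝ) * (4 / klE0) ^ (1 + ((e.1 : ℕ) + (e.2 : ℕ)) + 2)))) *
              (4608 * (1 + R.Gfr 0 + R.Gfr 1 + R.Gfr 2 + R.Gfr 3) ^ 4 * (((Nsc : ℝ) + 1) * U ^ 2 + 2 * |U|))) ≤ a)
    (hsmall : Real.exp 1 * a * |U| * (4 * Real.exp 1 ^ 4 *
        (256 * ((4 / 3) * Real.sqrt (24 * π ^ 2 * (R.Gfr 0 + 1) * (R.Gfr 2 + 1)) + (128 / 15) * (R.Gfr 0 + 1)) +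
          2 * (((Nsc : ℝ) + 1) * |U| * (6 * (Real.pi * R.Gfr 1 / 2 + Real.pi ^ 2 * R.Gfr 2 / (2 * Real.sqrt 2) + Real.pi ^ 3 * R.Gfr 3 / 8)))) +
        16 * Real.exp 1 ^ 8 * Real.sqrt (2 * (7 + 1606732)) ^ 2) ≤ 1 / 2) :
    TwoLegGridMomentsAt L M
      (4 * Real.exp 1 ^ 2 * a * (4 * Real.exp 1 ^ 4 *
        (256 * ((4 / 3) * Real.sqrt (24 * π ^ 2 * (R.Gfr 0 + 1) * (R.Gfr 2 + 1)) + (128 / 15) * (R.Gfr 0 + 1)) +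
          2 * (((Nsc : ℝ) + 1) * |U| * (6 * (Real.pi * R.Gfr 1 / 2 + Real.pi ^ 2 * R.Gfr 2 / (2 * Real.sqrt 2) + Real.pi ^ 3 * R.Gfr 3 / 8)))) +
        16 * Real.exp 1 ^ 8 * Real.sqrt (2 * (7 + 1606732)) ^ 2) ^ 2)
      (8 * Real.exp 1 ^ 2 * a * (4 * Real.exp 1 ^ 4 *
        (256 * ((4 / 3) * Real.sqrt (24 * π ^ 2 * (R.Gfr 0 + 1) * (R.Gfr 2 + 1)) + (128 / 15) * (R.Gfr 0 + 1)) +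
          2 * (((Nsc : ℝ) + 1) * |U| * (6 * (Real.pi * R.Gfr 1 / 2 + Real.pi ^ 2 * R.Gfr 2 / (2 * Real.sqrt 2) + Real.pi ^ 3 * R.Gfr 3 / 8)))) +
        16 * Real.exp 1 ^ 8 * Real.sqrt (2 * (7 + 1606732)) ^ 2) ^ 2) β U μ K 0 := by
  refine twoLegGridMomentsAt_scaleZero_of_frameOK hK hR hU hU1 hβ hL hM ha hA ?_ hsmall
  refine (sum_norm_framePosKernel_mul_weight_le_of_frameOK (L := L) hR hU.ne' hU1 hK).trans (le_of_eq ?_)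
  rw [show U ^ 2 = |U| * |U| by rw [← sq_abs]; ring]
  ring

end FrameBase

end Summit.HubbardSuperconductivity.HubbardSuperconductivity.Theorems.EngineV8

end
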